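import Literature.Geometry.Lorentzian.HypersurfaceHessian
import Literature.Geometry.Lorentzian.TracedGaussEquationGeneral
import Literature.Geometry.Lorentzian.SecondFundamentalFormApply
import Literature.Geometry.Lorentzian.GeodesicSpeed
import Literature.Geometry.Lorentzian.TwoParameterMaps
import Literature.Geometry.Lorentzian.DalembertianCompose
import Literature.Geometry.Lorentzian.KillingFieldCurvatureIdentities
import HarnessLib

/-!
# The lapse equation of a Killing field normal to a totally geodesic slice

For a spacelike immersed hypersurface `f : (Nᵐ, f^*g) → (Mᵐ⁺¹, g)` with unit normal `ν` of sign
`ε ≠ 0` and a Killing field `X` of `g` which along the slice is proportional to the normal,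
`X ∘ f = V ν` (`V` the **lapse**), at a point where the second fundamental form vanishes:

  `ε V Δ_{f^*g} V = -Ric_g(X, X)`        (`IsKillingField.lapse_mul_dalembertian_eq_neg_ricci`).

For a static space-time `g = -V² dt² + γ` (`X = ∂ₜ = V n`, `ε = -1`, static slices totally
geodesic) this is the classical identity `Δ_γ V = V⁻¹ Ric_g(∂ₜ, ∂ₜ) ∘ …`, i.e. the **lapse
equation `Δ_γ V = 0` of the static vacuum Einstein equations** — the equation on the Riemannian
data `(S, γ, V)` with which the uniqueness theorems of Israel, Bunting–Masood-ul-Alam and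
Chruściel start (Chruściel–Costa–Heusler 2012, §3.1; Heusler 1996, Ch. 2 and §9; Anderson 2000,
§1.2, (1.4): "`Δu = 0` from the vertical part `r_M(X, X)`"). It is proved here, with no named
facts, by evaluating O'Neill's identity `□ ⟨X,X⟩ = -2 tr(∇X ∘ ∇X) - 2 Ric(X,X)` for Killing fields
(O'Neill 1983, Ch. 9, Ex. 9; `KillingFieldCurvatureIdentities.lean`) on the slice:

* `trace_eq_trace_inducedMetric_add_div_general` — the tangent–normal split of the metric trace,
  `tr_g B = tr_{f^*g}(B ∘ (df × df)) + B(ν,ν)/ε`, in every dimension (the surface case is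
  `trace_eq_trace_inducedMetric_add_div` of `LevelSetMeanCurvature.lean`);
* `eq_zero_of_val_mfderiv_eq_zero_of_val_normal_eq_zero` — `T_{f y}M = df(T_y N) ⊕ ℝν`;
* `IsUnitNormal.val_normalDerivAlong_normal` (`g(D_u ν, ν) = 0`),
  `normalDerivAlong_eq_zero_of_secondFundamentalForm_eq_zero` (`K = 0 ⟹ Dν = 0`);
* `leviCivita_mfderiv_eq_of_eq_smul_normal` — `∇_{df u} X = dV(u) ν` for `X ∘ f = V ν`, `K = 0`;
* `IsKillingField.val_leviCivita_self_mfderiv_of_eq_smul_normal`,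
  `….val_leviCivita_self_normal_of_eq_smul_normal`, `….val_leviCivita_self_self_of_eq_smul_normal`
  — the acceleration `∇_X X = -ε V df(grad V)` of the Killing flow and `g(∇_X X, ∇_X X) =
  (εV)²|dV|²`;
* `IsKillingField.hessian_val_self_normal_normal_of_eq_smul_normal` (`Hess⟨X,X⟩(ν,ν) = 2ε²|dV|²`),
  `IsKillingField.trace_leviCivita_comp_self_of_eq_smul_normal` (`tr(∇X∘∇X) = -2ε|dV|²`);
* `IsKillingField.lapse_mul_dalembertian_eq_neg_ricci` — the lapse equation.
* Part 2 (appended): `IsKillingField.val_riemann_mfderiv_normal_normal_of_eq_smul_normal`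
  (`Rm_g(df u, ν, ν, df w) = −(ε/V) Hess_{f^*g}V(u,w)`),
  `ricci_inducedMetric_eq_of_secondFundamentalForm_eq_zero` (the contracted Gauss equation at a
  totally geodesic point, `Ric_{f^*g}(u,w) = Ric_g(df u, df w) − Rm_g(ν, df u, df w, ν)/ε`), and
  `IsKillingField.ricci_mfderiv_mfderiv_eq_of_eq_smul_normal` — the `(i,j)` static equations
  `Ric_g(df u, df w) = Ric_{f^*g}(u,w) − V⁻¹ Hess_{f^*g}V(u,w)`; with the lapse equation these are
  the static vacuum equations `Ric(γ) = V⁻¹∇²V`, `Δ_γ V = 0` (CCH 2012, §3.1).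

The specialisation to the canonical slice of a static vacuum black hole (`Δ_h V = 0`, discharging
the harmonicity hypothesis of the Bunting–Masood-ul-Alam rescalings) is in
`StaticBlackHoleUniquenessProofs.lean`. Everything is proved; there are no definitions and no
named facts.

## References

* [ONeill1983] B. O'Neill, *Semi-Riemannian geometry with applications to relativity*, Academic
  Press 1983: Ch. 3, Prop. 3.18, pp. 60–61; Ch. 4, Lemma 4.1, Prop. 4.13, Lemma 4.19,
  pp. 97–100; Ch. 9, Prop. 9.25, Exercises 8–9; Ch. 12 (static space-times).
* [ChruscielCostaHeusler2012] P. T. Chruściel, J. L. Costa, M. Heusler, *Stationary black holes: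
  uniqueness and beyond*, Living Rev. Relativity 15 (2012) 7, arXiv:1205.6112, §3.1.
* [Anderson2000] M. T. Anderson, Ann. Henri Poincaré 1 (2000) 977–994, §1.2, (1.4).
-/

noncomputable section

open Bundle Set Function Manifold FiberBundle
open scoped Manifold ContDiff Topology

namespace Literature.Geometry.Lorentzian

namespace PseudoRiemannianMetric

/-- `∑ᵢ ∑ⱼ (diag d)ⱼᵢ Tᵢⱼ = ∑ᵢ dᵢ Tᵢᵢ`. [folklore] -/
private theorem sum_sum_diagonal_mul_static {ι : Type*} [Fintype ι] [DecidableEq ι] (d : ι → ℝ)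
    (T : ι → ι → ℝ) : ∑ i, ∑ j, (Matrix.diagonal d) j i * T i j = ∑ i, d i * T i i := by
  refine Finset.sum_congr rfl fun i _ ↦ ?_
  rw [Finset.sum_eq_single i]
  · rw [Matrix.diagonal_apply_eq]
  · intro j _ hji
    rw [Matrix.diagonal_apply_ne _ hji, zero_mul]
  · intro h
    exact absurd (Finset.mem_univ i) h

variable {E : Type*} [NormedAddCommGroup E] [NormedSpace ℝ E] {H : Type*} [TopologicalSpace H]
  {I : ModelWithCorners ℝ E H} {M : Type*} [TopologicalSpace M] [ChartedSpace H M]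
  [IsManifold I ∞ M] [FiniteDimensional ℝ E] [CompleteSpace E] [I.Boundaryless]
  (g : PseudoRiemannianMetric I ∞ E (TangentSpace I : M → Type _)) [g.HasLeviCivita]
  {E' : Type*} [NormedAddCommGroup E'] [NormedSpace ℝ E'] {H' : Type*} [TopologicalSpace H']
  {I' : ModelWithCorners ℝ E' H'} {N : Type*} [TopologicalSpace N] [ChartedSpace H' N]
  [IsManifold I' ∞ N] [FiniteDimensional ℝ E'] [CompleteSpace E'] [I'.Boundaryless] {f : N → M}
  (hpb : PseudoRiemannianMetric.contMDiff_pullbackBilin I M I' N ∞)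
  (hfi : g.IsSpacelikeImmersion I' f) {ν : NormalField I f} {ε : ℝ}

omit [CompleteSpace E] [I.Boundaryless] [g.HasLeviCivita] [CompleteSpace E'] [I'.Boundaryless] in
/-- **The tangent–normal split of the metric trace on an immersed hypersurface, every
dimension.** For a spacelike immersion `f : (Nᵐ, f^*g) → (Mᵐ⁺¹, g)` with a unit normal `ν` of
sign `ε ≠ 0` and a bilinear form `B` on `T_{f y} M`:
`tr_g B = tr_{f^*g} (B ∘ (df_y × df_y)) + B(ν_y, ν_y) / ε` — in an `f^*g`-orthogonal basis `β` of
`T_y N`, `(df β₀, …, df βₘ₋₁, ν)` is a `g`-orthogonal basis of `T_{f y} M` (a dimension count) in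
which both traces are diagonal sums. The surface case `m = 2` is
`trace_eq_trace_inducedMetric_add_div` (`LevelSetMeanCurvature.lean`). O'Neill 1983, Ch. 3,
pp. 60–61 and Ch. 4, pp. 97–100. [cite: ONeill1983, Ch. 4, pp. 97–100] -/
theorem trace_eq_trace_inducedMetric_add_div_general (hun : g.IsUnitNormal I' f ν ε) (hε : ε ≠ 0)
    {m : ℕ} (hm : Module.finrank ℝ E' = m) (hm1 : Module.finrank ℝ E = m + 1) (y₀ : N)
    (B : LinearMap.BilinForm ℝ (TangentSpace I (f y₀))) :
    g.trace (f y₀) B =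
      (g.inducedMetric f hpb hfi).trace y₀
          (B.comp (mfderiv I' I f y₀).toLinearMap (mfderiv I' I f y₀).toLinearMap) +
        B (ν y₀) (ν y₀) / ε := by
  classical
  set gN := g.inducedMetric f hpb hfi with hgN
  obtain ⟨e, he, hde⟩ := exists_isOrthoᵢ_basis gN y₀
  have hfin : Module.finrank ℝ (TangentSpace I' y₀) = m := hm
  set β : Module.Basis (Fin m) ℝ (TangentSpace I' y₀) := e.reindex (finCongr hfin) with hβdef
  have hβapply : ∀ k, β k = e ((finCongr hfin).symm k) := fun k ↦ Module.Basis.reindex_apply _ _ _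
  have hβ : (gN.toBilinForm y₀).IsOrthoᵢ β := by
    intro k l hkl
    simp only [Function.onFun, hβapply]
    exact he fun h ↦ hkl ((finCongr hfin).symm.injective h)
  have hdβ : ∀ k, gN.val y₀ (β k) (β k) ≠ 0 := fun k ↦ by
    rw [hβapply]; exact hde _
  have hn0 : ∀ k, g.val (f y₀) (mfderiv I' I f y₀ (β k)) (ν y₀) = 0 := fun k ↦ by
    rw [g.symm]; exact hun.1 y₀ (β k)
  have hνε : g.val (f y₀) (ν y₀) (ν y₀) = ε := hun.2 y₀
  set v : Fin (m + 1) → TangentSpace I (f y₀) :=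
    Fin.snoc (α := fun _ ↦ TangentSpace I (f y₀)) (fun i ↦ mfderiv I' I f y₀ (β i)) (ν y₀)
    with hv
  have hvc : ∀ i : Fin m, v i.castSucc = mfderiv I' I f y₀ (β i) := fun i ↦ by
    simp [hv]
  have hvl : v (Fin.last m) = ν y₀ := by simp [hv]
  have hvo : (g.toBilinForm (f y₀)).IsOrthoᵢ v := by
    intro k l hkl
    simp only [Function.onFun, toBilinForm_apply]
    induction k using Fin.lastCases with
    | last =>
      induction l using Fin.lastCases with
      | last => exact absurd rfl hkl
      | cast j => rw [hvl, hvc, g.symm]; exact hn0 j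
    | cast i =>
      induction l using Fin.lastCases with
      | last => rw [hvl, hvc]; exact hn0 i
      | cast j =>
        rw [hvc, hvc]
        exact hβ fun h ↦ hkl (by rw [h])
  have hvd : ∀ k, g.toBilinForm (f y₀) (v k) (v k) ≠ 0 := by
    intro k
    induction k using Fin.lastCases with
    | last => rw [toBilinForm_apply, hvl, hνε]; exact hε
    | cast i => rw [toBilinForm_apply, hvc]; exact hdβ i
  have hli : LinearIndependent ℝ v := LinearMap.linearIndependent_of_isOrthoᵢ hvo hvd
  haveI : FiniteDimensional ℝ (TangentSpace I (f y₀)) := inferInstanceAs (FiniteDimensional ℝ E)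
  have hcard : Fintype.card (Fin (m + 1)) = Module.finrank ℝ (TangentSpace I (f y₀)) := by
    show Fintype.card (Fin (m + 1)) = Module.finrank ℝ E
    rw [hm1, Fintype.card_fin]
  set γ := basisOfLinearIndependentOfCardEqFinrank hli hcard with hγdef
  have hγ : ∀ k, γ k = v k := fun k ↦
    congrFun (coe_basisOfLinearIndependentOfCardEqFinrank hli hcard) k
  have hγo : (g.toBilinForm (f y₀)).IsOrthoᵢ γ := by
    intro k l hkl
    simp only [Function.onFun, hγ]
    exact hvo hkl
  have hγd : ∀ k, g.val (f y₀) (γ k) (γ k) ≠ 0 := fun k ↦ by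
    rw [hγ]; exact hvd k
  rw [trace_eq_sum_gram_inv g (f y₀) γ B, gram_inv_of_isOrthoᵢ g (f y₀) γ hγo hγd,
    sum_sum_diagonal_mul_static, trace_eq_sum_gram_inv gN y₀ β,
    gram_inv_of_isOrthoᵢ gN y₀ β hβ hdβ, sum_sum_diagonal_mul_static, Fin.sum_univ_castSucc]
  simp only [hγ, hvc, hvl, hνε, LinearMap.BilinForm.comp_apply, ContinuousLinearMap.coe_coe]
  have ha : ∀ k, g.val (f y₀) (mfderiv I' I f y₀ (β k)) (mfderiv I' I f y₀ (β k)) =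
      gN.val y₀ (β k) (β k) := fun k ↦ rfl
  simp only [ha, div_eq_inv_mul]

include hfi in
omit [CompleteSpace E] [g.HasLeviCivita] [CompleteSpace E'] [I'.Boundaryless] [I.Boundaryless]
  [IsManifold I' ∞ N] in
/-- **A vector with vanishing tangential and normal components is zero.** For a spacelike
immersion `f : Nᵐ → Mᵐ⁺¹` and a vector `ν` at `f y` normal to `df(T_y N)` with `g(ν, ν) = ε ≠ 0`:
if `g(A, df u) = 0` for all `u` and `g(A, ν) = 0` then `A = 0`, since
`df(T_y N) ⊕ ℝ ν = T_{f y} M` (a dimension count, `df_y` injective) and `g` is nondegenerate.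
O'Neill 1983, Ch. 4, pp. 97–100 (`T_p M̄ = T_p M ⊕ T_p M^⊥`). [cite: ONeill1983, Ch. 4, pp. 97–100] -/
theorem eq_zero_of_val_mfderiv_eq_zero_of_val_normal_eq_zero {y : N}
    {νy A : TangentSpace I (f y)} {ε : ℝ}
    (hν0 : ∀ u : TangentSpace I' y, g.val (f y) νy (mfderiv I' I f y u) = 0)
    (hνε : g.val (f y) νy νy = ε) (hε : ε ≠ 0)
    (hdim : Module.finrank ℝ E = Module.finrank ℝ E' + 1)
    (hA : ∀ u : TangentSpace I' y, g.val (f y) A (mfderiv I' I f y u) = 0)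
    (hAν : g.val (f y) A νy = 0) : A = 0 := by
  have hinj := hfi.injective_mfderiv y
  haveI : FiniteDimensional ℝ (TangentSpace I (f y)) := inferInstanceAs (FiniteDimensional ℝ E)
  set Φ : (E' × ℝ) →ₗ[ℝ] TangentSpace I (f y) :=
    (mfderiv I' I f y).toLinearMap.comp (LinearMap.fst ℝ E' ℝ) +
      (LinearMap.snd ℝ E' ℝ).smulRight νy with hΦ
  have hΦapply : ∀ (u : E') (r : ℝ), Φ (u, r) = mfderiv I' I f y u + r • νy :=
    fun u r ↦ rfl
  have hΦinj : Function.Injective Φ := by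
    refine (injective_iff_map_eq_zero _).2 fun q hq ↦ ?_
    obtain ⟨u, r⟩ := q
    rw [hΦapply] at hq
    have h1 : r * ε = 0 := by
      have := congrArg (fun w ↦ g.val (f y) νy w) hq
      simpa [map_add, map_smul, hν0 u, hνε] using this
    have hr : r = 0 := (mul_eq_zero.1 h1).resolve_right hε
    rw [hr, zero_smul, add_zero] at hq
    have hu : u = 0 := (injective_iff_map_eq_zero _).1 hinj u hq
    simp [hu, hr]
  have hrank : Module.finrank ℝ (E' × ℝ) = Module.finrank ℝ (TangentSpace I (f y)) := by
    show Module.finrank ℝ (E' × ℝ) = Module.finrank ℝ E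
    rw [Module.finrank_prod, Module.finrank_self, hdim]
  have hΦsurj : Function.Surjective Φ :=
    (LinearMap.injective_iff_surjective_of_finrank_eq_finrank hrank).1 hΦinj
  refine g.nondegenerate (f y) A fun w ↦ ?_
  obtain ⟨⟨u, r⟩, rfl⟩ := hΦsurj w
  rw [hΦapply, map_add, map_smul, hA u, hAν, smul_zero, add_zero]

omit [I.Boundaryless] [FiniteDimensional ℝ E'] [CompleteSpace E'] in
/-- **`g(D_u ν, ν) = 0` for a unit normal field** (with smooth lift): differentiate
`g(ν, ν) = ε` along the chart-straight curve with velocity `u` (product rule for the covariant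
derivative along a curve, O'Neill 1983, Ch. 3, Prop. 3.18 (3)). O'Neill 1983, Ch. 4, Lemma 4.19
ff. [cite: ONeill1983, Ch. 4, Lemma 4.19] -/
theorem IsUnitNormal.val_normalDerivAlong_normal (hun : g.IsUnitNormal I' f ν ε)
    (hν : ContMDiff I' I.tangent ∞
      (fun x ↦ (TotalSpace.mk' E (f x) (ν x) : TangentBundle I M)))
    (y : N) (u : TangentSpace I' y) :
    g.val (f y) (g.normalDerivAlong f ν y u) (ν y) = 0 := by
  set c : ℝ → N := curveThrough I' y u with hc_def
  have hLC := isLeviCivita_leviCivita_holds (g := g)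
  have hc0 : c 0 = y := curveThrough_zero I' y u
  have hνlift : MDifferentiableAt 𝓘(ℝ, ℝ) I.tangent
      (fun s ↦ (TotalSpace.mk' E (f (c s)) (ν (c s)) : TangentBundle I M)) 0 :=
    ((hν.contMDiffAt).comp 0 (contMDiffAt_curveThrough_zero y u)).mdifferentiableAt (by simp)
  have hd := g.hasDerivAt_val_apply_along hLC.2 (γ := fun s ↦ f (c s))
    (V := fun s ↦ ν (c s)) (W := fun s ↦ ν (c s)) (t₀ := 0) hνlift hνlift
  have hconst : (fun s ↦ g.val (f (c s)) (ν (c s)) (ν (c s))) = fun _ ↦ ε := by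
    funext s; exact hun.val_self (c s)
  rw [hconst] at hd
  have h0 := hd.unique (hasDerivAt_const 0 ε)
  rw [g.symm (f (c 0)) (ν (c 0))
    (covariantDerivAlong g.leviCivita (fun s ↦ f (c s)) (fun s ↦ ν (c s)) 0)] at h0
  have key : ∀ z : N, y = z →
      g.val (f y) (g.normalDerivAlong f ν y u) (ν y) =
      g.val (f z) (show TangentSpace I (f z) from
        covariantDerivAlong g.leviCivita (fun s ↦ f (c s)) (fun s ↦ ν (c s)) 0) (ν z) := by
    rintro z rfl; rfl
  rw [key _ hc0.symm]
  change g.val (f (c 0))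
    (covariantDerivAlong g.leviCivita (fun s ↦ f (c s)) (fun s ↦ ν (c s)) 0) (ν (c 0)) = 0
  linarith

include hfi in
omit [I.Boundaryless] [CompleteSpace E'] in
/-- **`K = 0` forces `Dν = 0`**: on a spacelike immersed hypersurface `f : Nᵐ → Mᵐ⁺¹` with unit
normal `ν` of sign `ε ≠ 0` (smooth lift), at a point where the second fundamental form vanishes
the normal field is parallel along `f`: `D_u ν = 0` for all `u ∈ T_y N` (its tangential
components are `K(u, ·) = 0`, `secondFundamentalForm_apply_holds`, and its normal component
vanishes, `val_normalDerivAlong_normal`). O'Neill 1983, Ch. 4, Def. 4.12–Prop. 4.13 (totally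
geodesic ⟺ shape tensor vanishes) with Lemma 4.19. [cite: ONeill1983, Ch. 4, Prop. 4.13] -/
theorem normalDerivAlong_eq_zero_of_secondFundamentalForm_eq_zero
    (hun : g.IsUnitNormal I' f ν ε) (hε : ε ≠ 0)
    (hν : ContMDiff I' I.tangent ∞
      (fun x ↦ (TotalSpace.mk' E (f x) (ν x) : TangentBundle I M)))
    (hdim : Module.finrank ℝ E = Module.finrank ℝ E' + 1) {y : N}
    (hK : g.secondFundamentalForm I' f ν y = 0) (u : TangentSpace I' y) :
    g.normalDerivAlong f ν y u = 0 := by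
  refine g.eq_zero_of_val_mfderiv_eq_zero_of_val_normal_eq_zero hfi (y := y) (νy := ν y)
    (fun u' ↦ hun.isNormalTo y u') (hun.val_self y) hε hdim (fun u' ↦ ?_)
    (hun.val_normalDerivAlong_normal g hν y u)
  have happ := secondFundamentalForm_apply_holds (g := g) (I' := I')
    BoundarylessManifold.isInteriorPoint ((hν y).mdifferentiableAt (by simp)) u u'
  rw [hK, LinearMap.zero_apply, LinearMap.zero_apply] at happ
  exact happ.symm

omit [CompleteSpace E] [FiniteDimensional ℝ E'] [CompleteSpace E'] [I'.Boundaryless]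
  [I.Boundaryless] in
/-- **`D_w (X ∘ f) = ∇_{df w} X`** (restriction of a vector field along a map; private copy of
`Literature.Geometry.Riemannian.normalDerivAlong_comp_eq_leviCivita`, whose file is not imported
here). O'Neill 1983, Ch. 3, Prop. 3.18 (3) and Ch. 4, Lemma 4.1. [cite: ONeill1983, Ch. 3, Prop. 3.18 (3)] -/
private theorem normalDerivAlong_restrict_eq' {X : Π x : M, TangentSpace I x} {y : N}
    (hy : I'.IsInteriorPoint y) (hf : MDifferentiableAt I' I f y)
    (hX : MDifferentiableAt I I.tangent (fun x ↦ (TotalSpace.mk' E x (X x) : TangentBundle I M))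
      (f y))
    (w : TangentSpace I' y) :
    g.normalDerivAlong f (fun x ↦ X (f x)) y w = g.leviCivita X (f y) (mfderiv I' I f y w) := by
  have hc := mdifferentiableAt_curveThrough_zero hy w
  have hf' : MDifferentiableAt I' I f (curveThrough I' y w 0) := by
    rw [curveThrough_zero]; exact hf
  have hX' : MDifferentiableAt I I.tangent
      (fun x ↦ (TotalSpace.mk' E x (X x) : TangentBundle I M)) ((f ∘ curveThrough I' y w) 0) := by
    rw [Function.comp_apply, curveThrough_zero]; exact hX
  have h := covariantDerivAlong_comp_holds g.leviCivita (γ := f ∘ curveThrough I' y w) (Y := X)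
    (t₀ := 0) (hf'.comp 0 hc) hX'
  have hv : velocity I (f ∘ curveThrough I' y w) 0 =
      mfderiv I' I f (curveThrough I' y w 0) (velocity I' (curveThrough I' y w) 0) := by
    simp only [velocity]
    rw [mfderiv_comp 0 hf' hc]
    rfl
  rw [hv] at h
  simp only [Function.comp_apply] at h
  rw [curveThrough_zero, velocity_curveThrough_zero_holds hy w] at h
  exact h

include hfi in
omit [CompleteSpace E'] [I.Boundaryless] in
/-- **Tangential derivatives of a field proportional to the unit normal of a totally geodesic
slice: `∇_{df u} X = dV(u) ν`.** Let `f : Nᵐ → Mᵐ⁺¹` be a spacelike immersion with unit normal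
`ν` of sign `ε ≠ 0` (smooth lift), `X` a vector field on `M` differentiable along `f` with
`X ∘ f = V ν` for a differentiable `V : N → ℝ`, and `y` a point where the second fundamental form
vanishes. Then `∇_{df_y u} X = dV_y(u) ν(y)` for all `u ∈ T_y N`: `∇_{df u} X = D_u(X ∘ f)`
(restriction, O'Neill 1983, Ch. 4, Lemma 4.1), `D_u(V ν) = (uV) ν + V D_u ν` (Prop. 3.18 (2))
and `D_u ν = 0` (`normalDerivAlong_eq_zero_of_secondFundamentalForm_eq_zero`). For the static
slices of `g = -V² dt² + γ` (`X = ∂ₜ = V n`) this is `∇_{e} ∂ₜ = e(V) n`. [cite: ONeill1983, Ch. 4, Lemma 4.1 and Prop. 4.13] -/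
theorem leviCivita_mfderiv_eq_of_eq_smul_normal
    (hun : g.IsUnitNormal I' f ν ε) (hε : ε ≠ 0)
    (hν : ContMDiff I' I.tangent ∞
      (fun x ↦ (TotalSpace.mk' E (f x) (ν x) : TangentBundle I M)))
    (hdim : Module.finrank ℝ E = Module.finrank ℝ E' + 1)
    {X : Π x : M, TangentSpace I x} (hXd : ∀ x, MDiffAt (T% X) x)
    {V : N → ℝ} (hVd : ∀ y, MDifferentiableAt I' 𝓘(ℝ, ℝ) V y)
    (hprop : ∀ y, X (f y) = V y • ν y) {y : N}
    (hK : g.secondFundamentalForm I' f ν y = 0) (u : TangentSpace I' y) :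
    g.leviCivita X (f y) (mfderiv I' I f y u) = mvfderiv I' V y u • ν y := by
  have hf : MDifferentiableAt I' I f y := (hfi.contMDiff y).mdifferentiableAt (by simp)
  rw [← g.normalDerivAlong_restrict_eq' BoundarylessManifold.isInteriorPoint hf (hXd (f y)) u]
  set c : ℝ → N := curveThrough I' y u with hc_def
  have hc0 : c 0 = y := curveThrough_zero I' y u
  have hcs : MDifferentiableAt 𝓘(ℝ, ℝ) I' c 0 :=
    mdifferentiableAt_curveThrough_zero BoundarylessManifold.isInteriorPoint u
  have hνlift : MDifferentiableAt 𝓘(ℝ, ℝ) I.tangent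
      (fun s ↦ (TotalSpace.mk' E (f (c s)) (ν (c s)) : TangentBundle I M)) 0 :=
    ((hν.contMDiffAt).comp 0 (contMDiffAt_curveThrough_zero y u)).mdifferentiableAt (by simp)
  have hV' : MDifferentiableAt I' 𝓘(ℝ, ℝ) V (c 0) := by rw [hc0]; exact hVd y
  have hVc : HasDerivAt (fun s ↦ V (c s)) (mfderiv I' 𝓘(ℝ, ℝ) V (c 0) (velocity I' c 0)) 0 :=
    hasDerivAt_comp_curve hV' hcs
  have hvc : velocity I' c 0 = u :=
    velocity_curveThrough_zero_holds BoundarylessManifold.isInteriorPoint u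
  have hderiv : deriv (fun s ↦ V (c s)) 0 = mvfderiv I' V y u := by
    rw [hVc.deriv]
    have key : ∀ z : N, z = y → ∀ u' : TangentSpace I' z, (show E' from u') = (show E' from u) →
        (mfderiv I' 𝓘(ℝ, ℝ) V z u' : ℝ) = mvfderiv I' V y u := by
      rintro z rfl u' rfl; rfl
    exact key _ hc0 _ hvc
  have hW : (fun t ↦ X (f (c t))) = fun t ↦ V (c t) • ν (c t) := by
    funext t; exact hprop (c t)
  have hL := covariantDerivAlong_smul_holds g.leviCivita (γ := fun s ↦ f (c s))
    (W := fun t ↦ ν (c t)) (f := fun t ↦ V (c t)) (t₀ := 0) hVc.differentiableAt hνlift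
  have hDν : g.normalDerivAlong f ν y u = 0 :=
    g.normalDerivAlong_eq_zero_of_secondFundamentalForm_eq_zero hfi hun hε hν hdim hK u
  change (covariantDerivAlong g.leviCivita (fun s ↦ f (c s)) (fun t ↦ X (f (c t))) 0 : E) = _
  rw [hW, hL, hderiv]
  have key : ∀ z : N, y = z →
      (show E from mvfderiv I' V y u • ν z) + (show E from V z •
        covariantDerivAlong g.leviCivita (fun s ↦ f (c s)) (fun s ↦ ν (c s)) 0) =
      (show E from mvfderiv I' V y u • ν y) := by
    rintro z rfl
    change (mvfderiv I' V y u • ν y + V y • g.normalDerivAlong f ν y u :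
      TangentSpace I (f y)) = _
    rw [hDν, smul_zero, add_zero]
  exact key _ hc0.symm

/-! ### The lapse equation `ε V Δ_{f^*g} V = -Ric(X, X)` -/

include hfi in
omit [CompleteSpace E'] [I.Boundaryless] in
/-- **The acceleration of the Killing flow along a slice to which the Killing field is normal.**
With `f, ν, ε, X = V ν ∘ f, K = 0` as in `leviCivita_mfderiv_eq_of_eq_smul_normal` and `X` a
Killing field: `g(∇_X X, df u) = -ε V dV(u)` (the Killing equation `g(∇_X X, w) = -g(∇_w X, X)`
with `∇_{df u} X = dV(u) ν`, `g(ν, X) = ε V`) and `g(∇_X X, ν) = 0` (`g(∇_X X, X) = 0`), i.e.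
`∇_X X = -ε V df(grad V)`: the static observers' acceleration is the gradient of the log-lapse.
O'Neill 1983, Ch. 9, Ex. 9 (a) (`grad ½⟨X,X⟩ = -D_X X`), Ch. 12 (static space-times);
Wald 1984, §6.1. [cite: ONeill1983, Ch. 9, Ex. 9 (a)] -/
theorem IsKillingField.val_leviCivita_self_mfderiv_of_eq_smul_normal
    (hun : g.IsUnitNormal I' f ν ε) (hε : ε ≠ 0)
    (hν : ContMDiff I' I.tangent ∞
      (fun x ↦ (TotalSpace.mk' E (f x) (ν x) : TangentBundle I M)))
    (hdim : Module.finrank ℝ E = Module.finrank ℝ E' + 1)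
    {X : Π x : M, TangentSpace I x} (hX : g.IsKillingField X)
    {V : N → ℝ} (hVd : ∀ y, MDifferentiableAt I' 𝓘(ℝ, ℝ) V y)
    (hprop : ∀ y, X (f y) = V y • ν y) {y : N}
    (hK : g.secondFundamentalForm I' f ν y = 0) (u : TangentSpace I' y) :
    g.val (f y) (g.leviCivita X (f y) (X (f y))) (mfderiv I' I f y u) =
      -(ε * V y * mvfderiv I' V y u) := by
  have hk := hX.2 (f y) (X (f y)) (mfderiv I' I f y u)
  have h2 : g.val (f y) (X (f y)) (mvfderiv I' V y u • ν y) = mvfderiv I' V y u * (V y * ε) := by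
    rw [map_smul, smul_eq_mul, hprop y, map_smul, _root_.smul_apply, hun.val_self y, smul_eq_mul]
  rw [g.leviCivita_mfderiv_eq_of_eq_smul_normal hfi hun hε hν hdim hX.mdifferentiableAt hVd
    hprop hK u, h2] at hk
  linarith

omit [IsManifold I' ∞ N] [FiniteDimensional ℝ E'] [CompleteSpace E'] [I'.Boundaryless]
  [I.Boundaryless] [FiniteDimensional ℝ E] [CompleteSpace E] [TopologicalSpace N] in
/-- `g(∇_X X, ν) = 0` along a slice with `X ∘ f = V ν`, `V ≠ 0` (the Killing equation gives
`g(∇_X X, X) = 0`). O'Neill 1983, Ch. 9, Prop. 9.25. [cite: ONeill1983, Ch. 9, Prop. 9.25] -/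
theorem IsKillingField.val_leviCivita_self_normal_of_eq_smul_normal
    {X : Π x : M, TangentSpace I x} (hX : g.IsKillingField X)
    {V : N → ℝ} (hprop : ∀ y, X (f y) = V y • ν y) {y : N} (hVy : V y ≠ 0) :
    g.val (f y) (g.leviCivita X (f y) (X (f y))) (ν y) = 0 := by
  have hk := hX.2 (f y) (X (f y)) (X (f y))
  rw [g.symm (f y) (X (f y)) (g.leviCivita X (f y) (X (f y)))] at hk
  have h0 : g.val (f y) (g.leviCivita X (f y) (X (f y))) (X (f y)) = 0 := by linarith
  rw [hprop y] at h0 ⊢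
  rw [map_smul] at h0
  simpa [hVy] using h0

include hfi hpb in
omit [CompleteSpace E'] [I.Boundaryless] in
/-- **`g(∇_X X, ∇_X X) = (ε V)² |dV|²_{f^*g}`** along a totally geodesic slice with
`X ∘ f = V ν`: by `val_leviCivita_self_mfderiv_of_eq_smul_normal` and
`val_leviCivita_self_normal_of_eq_smul_normal` the tangential part of `∇_X X` is
`-ε V grad V` and its normal part vanishes (`val_eq_inducedMetric_add_normal`). Here
`|dV|² = (f^*g)⁻¹(dV, dV)` (`innerDual`). O'Neill 1983, Ch. 9, Ex. 9 (a); Ch. 4, pp. 97–100.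
[cite: ONeill1983, Ch. 9, Ex. 9 (a)] -/
theorem IsKillingField.val_leviCivita_self_self_of_eq_smul_normal
    (hun : g.IsUnitNormal I' f ν ε) (hε : ε ≠ 0)
    (hν : ContMDiff I' I.tangent ∞
      (fun x ↦ (TotalSpace.mk' E (f x) (ν x) : TangentBundle I M)))
    (hdim : Module.finrank ℝ E = Module.finrank ℝ E' + 1)
    {X : Π x : M, TangentSpace I x} (hX : g.IsKillingField X)
    {V : N → ℝ} (hVd : ∀ y, MDifferentiableAt I' 𝓘(ℝ, ℝ) V y)
    (hprop : ∀ y, X (f y) = V y • ν y) {y : N}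
    (hK : g.secondFundamentalForm I' f ν y = 0) (hVy : V y ≠ 0) :
    g.val (f y) (g.leviCivita X (f y) (X (f y))) (g.leviCivita X (f y) (X (f y))) =
      (ε * V y) ^ 2 * (g.inducedMetric f hpb hfi).innerDual y
        (mvfderiv I' V y).toLinearMap (mvfderiv I' V y).toLinearMap := by
  set gN := g.inducedMetric f hpb hfi with hgN
  set A : TangentSpace I (f y) := g.leviCivita X (f y) (X (f y)) with hA
  set a : TangentSpace I' y := -(ε * V y) • gN.sharp y (mvfderiv I' V y).toLinearMap with ha
  have hAu : ∀ u : TangentSpace I' y, g.val (f y) A (mfderiv I' I f y u) = gN.val y a u := by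
    intro u
    rw [hA, hX.val_leviCivita_self_mfderiv_of_eq_smul_normal g hfi hun hε hν hdim hVd hprop hK u,
      ha, map_smul, _root_.smul_apply, val_sharp_apply, smul_eq_mul, ContinuousLinearMap.coe_coe]
    ring
  have key := val_eq_inducedMetric_add_normal g hpb hfi (y := y) (νy := ν y) (A := A) (B := A)
    (a := a) (b := a) (ε := ε) (fun u ↦ hun.isNormalTo y u) (hun.val_self y) hε hdim hAu hAu
  rw [key, hA, hX.val_leviCivita_self_normal_of_eq_smul_normal g hprop hVy, mul_zero, zero_div,
    add_zero, ha]
  simp only [map_smul, _root_.smul_apply, smul_eq_mul]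
  rw [← innerDual_eq_val_sharp_sharp]
  ring

include hfi hpb in
omit [CompleteSpace E'] [I.Boundaryless] in
/-- **`g(∇_ν X, ∇_ν X) = ε² |dV|²`** (with `ν = V⁻¹ X` along the slice, `∇_ν X = V⁻¹ ∇_X X`).
[cite: ONeill1983, Ch. 9, Ex. 9 (a)] -/
theorem IsKillingField.val_leviCivita_normal_normal_of_eq_smul_normal
    (hun : g.IsUnitNormal I' f ν ε) (hε : ε ≠ 0)
    (hν : ContMDiff I' I.tangent ∞
      (fun x ↦ (TotalSpace.mk' E (f x) (ν x) : TangentBundle I M)))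
    (hdim : Module.finrank ℝ E = Module.finrank ℝ E' + 1)
    {X : Π x : M, TangentSpace I x} (hX : g.IsKillingField X)
    {V : N → ℝ} (hVd : ∀ y, MDifferentiableAt I' 𝓘(ℝ, ℝ) V y)
    (hprop : ∀ y, X (f y) = V y • ν y) {y : N}
    (hK : g.secondFundamentalForm I' f ν y = 0) (hVy : V y ≠ 0) :
    g.val (f y) (g.leviCivita X (f y) (ν y)) (g.leviCivita X (f y) (ν y)) =
      ε ^ 2 * (g.inducedMetric f hpb hfi).innerDual y
        (mvfderiv I' V y).toLinearMap (mvfderiv I' V y).toLinearMap := by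
  have hn : ν y = (V y)⁻¹ • X (f y) := by
    rw [hprop y, smul_smul, inv_mul_cancel₀ hVy, one_smul]
  have hAν : g.leviCivita X (f y) (ν y) = (V y)⁻¹ • g.leviCivita X (f y) (X (f y)) := by
    conv_lhs => rw [hn]
    rw [map_smul]
  rw [hAν]
  simp only [map_smul, _root_.smul_apply, smul_eq_mul]
  rw [hX.val_leviCivita_self_self_of_eq_smul_normal g hpb hfi hun hε hν hdim hVd hprop hK hVy]
  field_simp

include hfi hpb in
omit [CompleteSpace E'] [I.Boundaryless] in
/-- **The normal–normal component of `Hess ⟨X, X⟩`**: `Hess(g(X,X))(ν, ν) = 2 ε² |dV|²` along a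
totally geodesic slice with `X ∘ f = V ν` — O'Neill 1983, Ch. 9, Ex. 9 (b)
(`hessian_val_self_apply`) with `R(ν, X) = V R(ν, ν) = 0` and `g(∇_ν X, ∇_ν X) = ε²|dV|²`.
[cite: ONeill1983, Ch. 9, Ex. 9 (b)] -/
theorem IsKillingField.hessian_val_self_normal_normal_of_eq_smul_normal
    (hun : g.IsUnitNormal I' f ν ε) (hε : ε ≠ 0)
    (hν : ContMDiff I' I.tangent ∞
      (fun x ↦ (TotalSpace.mk' E (f x) (ν x) : TangentBundle I M)))
    (hdim : Module.finrank ℝ E = Module.finrank ℝ E' + 1)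
    {X : Π x : M, TangentSpace I x} (hX : g.IsKillingField X)
    {V : N → ℝ} (hVd : ∀ y, MDifferentiableAt I' 𝓘(ℝ, ℝ) V y)
    (hprop : ∀ y, X (f y) = V y • ν y) {y : N}
    (hK : g.secondFundamentalForm I' f ν y = 0) (hVy : V y ≠ 0) :
    g.hessian (fun z ↦ g.val z (X z) (X z)) (f y) (ν y) (ν y) =
      2 * ε ^ 2 * (g.inducedMetric f hpb hfi).innerDual y
        (mvfderiv I' V y).toLinearMap (mvfderiv I' V y).toLinearMap := by
  have hR : g.riemann (f y) (ν y) (X (f y)) = 0 := by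
    rw [hprop y, map_smul]
    ext w
    simp [riemann]
  rw [hX.hessian_val_self_apply ENat.LEInfty.out (ν y) (ν y), hR, zero_apply, map_zero, zero_apply,
    mul_zero, sub_zero, hX.val_leviCivita_normal_normal_of_eq_smul_normal g hpb hfi hun hε hν hdim
      hVd hprop hK hVy]
  ring

include hfi hpb in
omit [CompleteSpace E'] [I.Boundaryless] in
/-- **`tr(∇X ∘ ∇X) = -2 ε |dV|²`** along a totally geodesic slice with `X ∘ f = V ν`: split the
metric trace of `(v, w) ↦ g(∇_{∇_v X} X, w)` (`trace_compLeft_toBilinForm`) into its tangential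
and normal parts (`trace_eq_trace_inducedMetric_add_div_general`); by the Killing equation
`g(∇_{∇_v X} X, w) = -g(∇_v X, ∇_w X)`, which is `-ε dV(u) dV(u')` on `(df u, df u')`
(`leviCivita_mfderiv_eq_of_eq_smul_normal`) and `-ε² |dV|²` on `(ν, ν)`. This is the term
`trace(DX ∘ DX)` of O'Neill 1983, Ch. 9, Ex. 9 (c) for a static Killing field.
[cite: ONeill1983, Ch. 9, Ex. 9 (c)] -/
theorem IsKillingField.trace_leviCivita_comp_self_of_eq_smul_normal
    (hun : g.IsUnitNormal I' f ν ε) (hε : ε ≠ 0)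
    (hν : ContMDiff I' I.tangent ∞
      (fun x ↦ (TotalSpace.mk' E (f x) (ν x) : TangentBundle I M)))
    (hdim : Module.finrank ℝ E = Module.finrank ℝ E' + 1)
    {X : Π x : M, TangentSpace I x} (hX : g.IsKillingField X)
    {V : N → ℝ} (hVd : ∀ y, MDifferentiableAt I' 𝓘(ℝ, ℝ) V y)
    (hprop : ∀ y, X (f y) = V y • ν y) {y : N}
    (hK : g.secondFundamentalForm I' f ν y = 0) (hVy : V y ≠ 0) :
    LinearMap.trace ℝ (TangentSpace I (f y))
        ((g.leviCivita X (f y)).toLinearMap ∘ₗ (g.leviCivita X (f y)).toLinearMap) =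
      -2 * ε * (g.inducedMetric f hpb hfi).innerDual y
        (mvfderiv I' V y).toLinearMap (mvfderiv I' V y).toLinearMap := by
  set gN := g.inducedMetric f hpb hfi with hgN
  set q := gN.innerDual y (mvfderiv I' V y).toLinearMap (mvfderiv I' V y).toLinearMap with hq
  set Acl := g.leviCivita X (f y) with hAcl
  set B : LinearMap.BilinForm ℝ (TangentSpace I (f y)) :=
    (g.toBilinForm (f y)).compLeft (Acl.toLinearMap ∘ₗ Acl.toLinearMap) with hB
  have hBapply : ∀ v w, B v w = -g.val (f y) (Acl v) (Acl w) := by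
    intro v w
    have hk := hX.2 (f y) (Acl v) w
    simp only [hB, LinearMap.BilinForm.compLeft_apply, toBilinForm_apply, LinearMap.coe_comp,
      Function.comp_apply, ContinuousLinearMap.coe_coe]
    linarith
  rw [← trace_compLeft_toBilinForm (g := g) (f y),
    g.trace_eq_trace_inducedMetric_add_div_general hpb hfi hun hε rfl hdim y B]
  -- the normal part
  have hνν : B (ν y) (ν y) = -(ε ^ 2 * q) := by
    rw [hBapply, hX.val_leviCivita_normal_normal_of_eq_smul_normal g hpb hfi hun hε hν hdim hVd
      hprop hK hVy]
  -- the tangential part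
  have hcomp : B.comp (mfderiv I' I f y).toLinearMap (mfderiv I' I f y).toLinearMap =
      (-ε) • ((mvfderiv I' V y).toLinearMap.smulRight (mvfderiv I' V y).toLinearMap) := by
    refine LinearMap.ext fun u ↦ LinearMap.ext fun u' ↦ ?_
    simp only [LinearMap.BilinForm.comp_apply, ContinuousLinearMap.coe_coe, hBapply,
      LinearMap.smul_apply, LinearMap.smulRight_apply, smul_eq_mul, hAcl,
      g.leviCivita_mfderiv_eq_of_eq_smul_normal hfi hun hε hν hdim hX.mdifferentiableAt hVd
        hprop hK, map_smul, _root_.smul_apply, hun.val_self y]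
    ring
  rw [hνν, hcomp, trace_smul, trace_smulRight_dual]
  field_simp
  ring

include hfi hpb in
/-- **The lapse equation of a Killing field normal to a totally geodesic slice:
`ε V Δ_{f^*g} V = -Ric(X, X)`.** Let `f : (Nᵐ, f^*g) → (Mᵐ⁺¹, g)` be a spacelike immersion with
unit normal `ν` of sign `ε ≠ 0` (smooth lift), `X` a Killing field of `g` with `X ∘ f = V ν` for a
`C²` function `V : N → ℝ`, and `y` a point with `K(y) = 0` and `V(y) ≠ 0`. Then
`ε V(y) (Δ_{f^*g} V)(y) = -Ric_g(X, X)(f y)`. Proof (O'Neill 1983, Ch. 9, Ex. 9 evaluated on the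
slice; Chruściel–Costa–Heusler 2012, §3.1; Anderson 2000, §1.2, (1.4)): `φ = g(X,X)` restricts to
`ε V²`, so `Δ(φ ∘ f) = 2εVΔV + 2ε|dV|²` (`dalembertian_real_comp`); on the other hand
`Δ(φ ∘ f) = tr_{f^*g}(Hess φ ∘ (df × df))` (`dalembertian_comp_eq`, `H = 0`)
`= □φ - Hess φ(ν,ν)/ε` (`trace_eq_trace_inducedMetric_add_div_general`)
`= (-2 tr(∇X∘∇X) - 2 Ric(X,X)) - 2ε|dV|²` (`dalembertian_val_self`,
`hessian_val_self_normal_normal_of_eq_smul_normal`) `= 4ε|dV|² - 2Ric(X,X) - 2ε|dV|²`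
(`trace_leviCivita_comp_self_of_eq_smul_normal`). For a static vacuum space-time
(`ε = -1`, `Ric = 0`) this is **`Δ_γ V = 0`**, the lapse equation of the Riemannian problem
`(S, γ, V)` of Israel's theorem and of Bunting–Masood-ul-Alam's proof. [cite: ChruscielCostaHeusler2012, §3.1 (static vacuum: Δ_γ V = 0)] -/
theorem IsKillingField.lapse_mul_dalembertian_eq_neg_ricci
    (hun : g.IsUnitNormal I' f ν ε) (hε : ε ≠ 0)
    (hν : ContMDiff I' I.tangent ∞
      (fun x ↦ (TotalSpace.mk' E (f x) (ν x) : TangentBundle I M)))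
    (hdim : Module.finrank ℝ E = Module.finrank ℝ E' + 1)
    {X : Π x : M, TangentSpace I x} (hX : g.IsKillingField X)
    {V : N → ℝ} (hV2 : ContMDiff I' 𝓘(ℝ, ℝ) 2 V)
    (hprop : ∀ y, X (f y) = V y • ν y) {y : N}
    (hK : g.secondFundamentalForm I' f ν y = 0) (hVy : V y ≠ 0) :
    haveI := (g.inducedMetric f hpb hfi).hasLeviCivita
    ε * (V y * (g.inducedMetric f hpb hfi).dalembertian V y) =
      -g.ricci (f y) (X (f y)) (X (f y)) := by
  haveI := (g.inducedMetric f hpb hfi).hasLeviCivita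
  set gN := g.inducedMetric f hpb hfi with hgN
  set q := gN.innerDual y (mvfderiv I' V y).toLinearMap (mvfderiv I' V y).toLinearMap with hq
  set φ : M → ℝ := fun z ↦ g.val z (X z) (X z) with hφ
  have hVd : ∀ y, MDifferentiableAt I' 𝓘(ℝ, ℝ) V y := fun y ↦
    (hV2 y).mdifferentiableAt two_ne_zero
  have hX2 : CMDiff 2 (T% X) := hX.contMDiff_two ENat.LEInfty.out
  have hφ2 : CMDiff 2 φ := fun z ↦ g.contMDiffAt_val_apply ENat.LEInfty.out (hX2 z) (hX2 z)
  -- (1) the restricted Laplacian, `H = 0`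
  have hH : g.meanCurvature f hpb hfi ν y = 0 := by
    rw [meanCurvature, hK, trace_zero]
  have h1 := g.dalembertian_comp_eq hpb hfi hν hun hε hdim hφ2 y
  rw [hH, mul_zero, sub_zero] at h1
  -- (2) the trace split of `Hess φ`
  have h2 := g.trace_eq_trace_inducedMetric_add_div_general hpb hfi hun hε rfl hdim y
    (g.hessian φ (f y))
  rw [hX.hessian_val_self_normal_normal_of_eq_smul_normal g hpb hfi hun hε hν hdim hVd hprop hK
    hVy] at h2
  -- (3) `□ φ = -2 tr(∇X∘∇X) - 2 Ric(X,X)` and `tr(∇X∘∇X) = -2ε|dV|²`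
  have h3 := hX.dalembertian_val_self ENat.LEInfty.out (f y)
  rw [hX.trace_leviCivita_comp_self_of_eq_smul_normal g hpb hfi hun hε hν hdim hVd hprop hK hVy]
    at h3
  have h23 : g.dalembertian φ (f y) = g.trace (f y) (g.hessian φ (f y)) := rfl
  -- (4) `φ ∘ f = ε V²`, so `Δ(φ ∘ f) = 2ε|dV|² + 2εVΔV`
  have hcomp : (fun y' ↦ φ (f y')) = (fun t : ℝ ↦ ε * t ^ 2) ∘ V := by
    funext y'
    simp only [hφ, Function.comp_apply, hprop y', map_smul, _root_.smul_apply, hun.val_self y',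
      smul_eq_mul]
    ring
  have hζ1 : ∀ t : ℝ, HasDerivAt (fun t : ℝ ↦ ε * t ^ 2) (2 * ε * t) t := fun t ↦
    ((hasDerivAt_pow 2 t).const_mul ε).congr_deriv (by ring)
  have hd1 : deriv (fun t : ℝ ↦ ε * t ^ 2) = fun t ↦ 2 * ε * t := funext fun t ↦ (hζ1 t).deriv
  have hd2 : deriv (deriv (fun t : ℝ ↦ ε * t ^ 2)) (V y) = 2 * ε := by
    rw [hd1]
    have h := (hasDerivAt_id (V y)).const_mul (2 * ε)
    simp only [mul_one, id] at h
    exact h.deriv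
  have hζ : ContDiffAt ℝ 2 (fun t : ℝ ↦ ε * t ^ 2) (V y) :=
    (contDiffAt_const.mul (contDiffAt_id.pow 2))
  have h4 := gN.dalembertian_real_comp (hV2 y) hζ
  rw [hd2, hd1] at h4
  rw [hcomp, h4] at h1
  -- assemble
  rw [h23] at h3
  have hsimp : 2 * ε ^ 2 * q / ε = 2 * ε * q := by
    field_simp
  rw [hsimp] at h2
  simp only at h1
  -- h1 : 2ε q + 2εV ΔV = T ;  h2 : □φ = T + 2εq ; h3 : □φ = -2(-2εq) - 2Ric
  nlinarith [h1, h2, h3]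

end PseudoRiemannianMetric

end Literature.Geometry.Lorentzian

/-! ## Part 2 (v2 of this file): the `(i,j)` static equations `Ric_g(df u, df w) = Ric_{f^*g}(u,w) − V⁻¹ Hess V(u,w)`

Appended 2026-08-15 (same seat): the normal curvatures `Rm_g(df u, ν, ν, df w) = −(ε/V) Hess V(u,w)`
(`IsKillingField.val_riemann_mfderiv_normal_normal_of_eq_smul_normal`), the contracted Gauss equation at a
totally geodesic point (`ricci_inducedMetric_eq_of_secondFundamentalForm_eq_zero`, from the frame Gauss equation by
polarisation on sheared bases) and the tangential Ricci identity
(`IsKillingField.ricci_mfderiv_mfderiv_eq_of_eq_smul_normal`). Part 1 above is unchanged. -/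

namespace Literature.Geometry.Lorentzian

namespace PseudoRiemannianMetric

variable {E : Type*} [NormedAddCommGroup E] [NormedSpace ℝ E] {H : Type*} [TopologicalSpace H]
  {I : ModelWithCorners ℝ E H} {M : Type*} [TopologicalSpace M] [ChartedSpace H M]
  [IsManifold I ∞ M] [FiniteDimensional ℝ E] [CompleteSpace E] [I.Boundaryless]
  (g : PseudoRiemannianMetric I ∞ E (TangentSpace I : M → Type _)) [g.HasLeviCivita]
  {E' : Type*} [NormedAddCommGroup E'] [NormedSpace ℝ E'] {H' : Type*} [TopologicalSpace H']
  {I' : ModelWithCorners ℝ E' H'} {N : Type*} [TopologicalSpace N] [ChartedSpace H' N]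
  [IsManifold I' ∞ N] [FiniteDimensional ℝ E'] [CompleteSpace E'] [I'.Boundaryless] {f : N → M}
  (hpb : PseudoRiemannianMetric.contMDiff_pullbackBilin I M I' N ∞)
  (hfi : g.IsSpacelikeImmersion I' f) {ν : NormalField I f} {ε : ℝ}

include hfi hpb in
/-- **The normal curvatures of a Killing field normal to a totally geodesic slice:
`g(R(df u, ν) ν, df w) = -(ε/V) Hess_{f^*g} V(u, w)`.** With `f, ν, ε, X = V ν ∘ f` as in
`IsKillingField.lapse_mul_dalembertian_eq_neg_ricci` (`X` Killing, `V ∈ C²`, `K(y) = 0`,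
`V(y) ≠ 0`), for all `u, w ∈ T_y N` the curvature component `Rm_g(df u, ν, ν, df w)` equals
`-(ε/V) Hess_{f^*g}V(u,w)`. Proof: restrict `φ = g(X,X)` (`= εV²` on the slice) to `N`:
`Hess_{f^*g}(φ∘f)(u,w) = Hess_g φ(df u, df w)` (`hessian_comp_apply`, `K = 0`)
`= 2g(∇_{df u}X, ∇_{df w}X) - 2g(R(df u,X)X, df w)` (O'Neill 1983, Ch. 9, Ex. 9 (b),
`hessian_val_self_apply`) `= 2ε dV(u)dV(w) - 2V² Rm_g(df u,ν,ν,df w)`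
(`leviCivita_mfderiv_eq_of_eq_smul_normal`), while `Hess(εV²) = 2ε dV ⊗ dV + 2εV Hess V`
(`hessian_real_comp`). For `g = -V²dt² + γ` these are the components `R_g(eᵢ, n, n, eⱼ) =
V⁻¹ ∇ᵢ∇ⱼV` behind the static field equations `Ric(γ) = V⁻¹∇²V + …`. Chruściel–Costa–Heusler
2012, §3.1; O'Neill 1983, Ch. 12 (static space-times), Ch. 7, Prop. 7.35 ff. (warped products).
[cite: ChruscielCostaHeusler2012, §3.1 (static field equations)] -/
theorem IsKillingField.val_riemann_mfderiv_normal_normal_of_eq_smul_normal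
    (hun : g.IsUnitNormal I' f ν ε) (hε : ε ≠ 0)
    (hν : ContMDiff I' I.tangent ∞
      (fun x ↦ (TotalSpace.mk' E (f x) (ν x) : TangentBundle I M)))
    (hdim : Module.finrank ℝ E = Module.finrank ℝ E' + 1)
    {X : Π x : M, TangentSpace I x} (hX : g.IsKillingField X)
    {V : N → ℝ} (hV2 : ContMDiff I' 𝓘(ℝ, ℝ) 2 V)
    (hprop : ∀ y, X (f y) = V y • ν y) {y : N}
    (hK : g.secondFundamentalForm I' f ν y = 0) (hVy : V y ≠ 0) (u w : TangentSpace I' y) :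
    haveI := (g.inducedMetric f hpb hfi).hasLeviCivita
    g.val (f y) (g.riemann (f y) (mfderiv I' I f y u) (ν y) (ν y)) (mfderiv I' I f y w) =
      -(ε / V y) * (g.inducedMetric f hpb hfi).hessian V y u w := by
  haveI := (g.inducedMetric f hpb hfi).hasLeviCivita
  set gN := g.inducedMetric f hpb hfi with hgN
  set φ : M → ℝ := fun z ↦ g.val z (X z) (X z) with hφ
  have hVd : ∀ y, MDifferentiableAt I' 𝓘(ℝ, ℝ) V y := fun y ↦
    (hV2 y).mdifferentiableAt two_ne_zero
  have hX2 : CMDiff 2 (T% X) := hX.contMDiff_two ENat.LEInfty.out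
  have hφ2 : CMDiff 2 φ := fun z ↦ g.contMDiffAt_val_apply ENat.LEInfty.out (hX2 z) (hX2 z)
  -- (1) the restricted Hessian (`K(y) = 0`)
  have h1 := g.hessian_comp_apply hpb hfi hν hun hε hdim hφ2 y u w
  rw [hK, LinearMap.zero_apply, LinearMap.zero_apply, mul_zero, sub_zero] at h1
  -- (2) Ex. 9 (b) on `(df u, df w)`
  have h2 := hX.hessian_val_self_apply ENat.LEInfty.out (mfderiv I' I f y u) (mfderiv I' I f y w)
  rw [g.leviCivita_mfderiv_eq_of_eq_smul_normal hfi hun hε hν hdim hX.mdifferentiableAt hVd hprop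
    hK u, g.leviCivita_mfderiv_eq_of_eq_smul_normal hfi hun hε hν hdim hX.mdifferentiableAt hVd
    hprop hK w] at h2
  have h2a : g.val (f y) (mvfderiv I' V y u • ν y) (mvfderiv I' V y w • ν y) =
      ε * (mvfderiv I' V y u * mvfderiv I' V y w) := by
    simp only [map_smul, _root_.smul_apply, smul_eq_mul, hun.val_self y]
    ring
  have h2b : g.val (f y) (g.riemann (f y) (mfderiv I' I f y u) (X (f y)) (X (f y)))
      (mfderiv I' I f y w) =
      V y ^ 2 * g.val (f y) (g.riemann (f y) (mfderiv I' I f y u) (ν y) (ν y))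
        (mfderiv I' I f y w) := by
    rw [hprop y]
    simp only [map_smul, _root_.smul_apply, smul_eq_mul]
    ring
  rw [h2a, h2b] at h2
  -- (3) `φ ∘ f = ε V²`
  have hcomp : (fun y' ↦ φ (f y')) = (fun t : ℝ ↦ ε * t ^ 2) ∘ V := by
    funext y'
    simp only [hφ, Function.comp_apply, hprop y', map_smul, _root_.smul_apply, hun.val_self y',
      smul_eq_mul]
    ring
  have hζ1 : ∀ t : ℝ, HasDerivAt (fun t : ℝ ↦ ε * t ^ 2) (2 * ε * t) t := fun t ↦
    ((hasDerivAt_pow 2 t).const_mul ε).congr_deriv (by ring)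
  have hd1 : deriv (fun t : ℝ ↦ ε * t ^ 2) = fun t ↦ 2 * ε * t := funext fun t ↦ (hζ1 t).deriv
  have hd2 : deriv (deriv (fun t : ℝ ↦ ε * t ^ 2)) (V y) = 2 * ε := by
    rw [hd1]
    have h := (hasDerivAt_id (V y)).const_mul (2 * ε)
    simp only [mul_one, id] at h
    exact h.deriv
  have hζ : ContDiffAt ℝ 2 (fun t : ℝ ↦ ε * t ^ 2) (V y) :=
    (contDiffAt_const.mul (contDiffAt_id.pow 2))
  have h3 := gN.hessian_real_comp (hV2 y) hζ u w
  rw [hd2, hd1] at h3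
  rw [hcomp, h3, h2] at h1
  simp only at h1
  -- h1 : 2ε dV(u)dV(w) + 2εV Hess V(u,w) = 2ε dV(u)dV(w) - 2V² Rνν(u,w)
  set R := g.val (f y) (g.riemann (f y) (mfderiv I' I f y u) (ν y) (ν y)) (mfderiv I' I f y w)
    with hR
  set Hs := (g.inducedMetric f hpb hfi).hessian V y u w with hHs
  have h4 : 2 * V y * (ε * Hs + V y * R) = 0 := by linear_combination h1
  have h5 : ε * Hs + V y * R = 0 := by
    rcases mul_eq_zero.1 h4 with h | h
    · exact absurd h (mul_ne_zero two_ne_zero hVy)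
    · exact h
  rw [show -(ε / V y) * Hs = -(ε * Hs) / V y by ring, eq_div_iff hVy]
  linear_combination h5

include hfi hpb in
omit [I.Boundaryless] in
/-- **The contracted Gauss equation of a totally geodesic point (Ricci form).** For a spacelike
immersion `f : (Nᵐ, f^*g) → (Mᵐ⁺¹, g)` with unit normal `ν` of sign `ε ≠ 0` (smooth lift) and a
point `y` with `K(y) = 0`: for all `u, w ∈ T_y N`,
`Ric_{f^*g}(u, w) = Ric_g(df u, df w) − g(R(ν, df u) df w, ν)/ε` — the trace over an adapted
orthogonal frame `(df β₁, …, df βₘ, ν)` of the Gauss equation `Rm_{f^*g}(b,u,w,b) =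
Rm_g(df b, df u, df w, df b)` (`K = 0`), which is obtained from the frame form
`gauss_equation_localFrame` (sectional components on an arbitrary basis) by polarisation
`u ↦ βⱼ + βₖ` on sheared bases. O'Neill 1983, Ch. 4, Thm. 4.5 and Cor. 4.6 (Gauss equation),
Ch. 3, Lemma 3.52 (Ricci in a frame); Wald 1984, (10.2.23)–(10.2.30) (`K = 0`).
[cite: ONeill1983, Ch. 4, Thm. 4.5] -/
theorem ricci_inducedMetric_eq_of_secondFundamentalForm_eq_zero
    (hν : ContMDiff I' I.tangent ∞
      (fun x ↦ (TotalSpace.mk' E (f x) (ν x) : TangentBundle I M)))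
    (hun : g.IsUnitNormal I' f ν ε) (hε : ε ≠ 0)
    (hdim : Module.finrank ℝ E = Module.finrank ℝ E' + 1) {y₀ : N}
    (hK : g.secondFundamentalForm I' f ν y₀ = 0) (u w : TangentSpace I' y₀) :
    haveI := (g.inducedMetric f hpb hfi).hasLeviCivita
    (g.inducedMetric f hpb hfi).ricci y₀ u w =
      g.ricci (f y₀) (mfderiv I' I f y₀ u) (mfderiv I' I f y₀ w) -
        g.val (f y₀) (g.riemann (f y₀) (ν y₀) (mfderiv I' I f y₀ u) (mfderiv I' I f y₀ w))
          (ν y₀) / ε := by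
  haveI := (g.inducedMetric f hpb hfi).hasLeviCivita
  classical
  set gN := g.inducedMetric f hpb hfi with hgN
  set m := Module.finrank ℝ E' with hm
  have hLC : g.IsLeviCivita g.leviCivita := isLeviCivita_leviCivita_holds
  have hLCN : gN.IsLeviCivita gN.leviCivita := isLeviCivita_leviCivita_holds
  -- an orthogonal basis `β` of `(T_{y₀} N, f^*g)` indexed by `Fin m`
  obtain ⟨e, he, hde⟩ := exists_isOrthoᵢ_basis gN y₀
  have hfin : Module.finrank ℝ (TangentSpace I' y₀) = m := hm
  set β : Module.Basis (Fin m) ℝ (TangentSpace I' y₀) := e.reindex (finCongr hfin) with hβdef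
  have hβapply : ∀ k, β k = e ((finCongr hfin).symm k) := fun k ↦ Module.Basis.reindex_apply _ _ _
  have hβ : (gN.toBilinForm y₀).IsOrthoᵢ β := by
    intro k l hkl
    simp only [Function.onFun, hβapply]
    exact he fun h ↦ hkl ((finCongr hfin).symm.injective h)
  have hdβ : ∀ k, gN.val y₀ (β k) (β k) ≠ 0 := fun k ↦ by
    rw [hβapply]; exact hde _
  -- the adapted orthogonal basis `(df β₀, …, df βₘ₋₁, ν)` of `T_{f y₀} M`
  have hn0 : ∀ k, g.val (f y₀) (mfderiv I' I f y₀ (β k)) (ν y₀) = 0 := fun k ↦ by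
    rw [g.symm]; exact hun.1 y₀ (β k)
  have hνε : g.val (f y₀) (ν y₀) (ν y₀) = ε := hun.2 y₀
  set v : Fin (m + 1) → TangentSpace I (f y₀) :=
    Fin.snoc (α := fun _ ↦ TangentSpace I (f y₀)) (fun i ↦ mfderiv I' I f y₀ (β i)) (ν y₀)
    with hv
  have hvc : ∀ i : Fin m, v i.castSucc = mfderiv I' I f y₀ (β i) := fun i ↦ by
    simp [hv]
  have hvl : v (Fin.last m) = ν y₀ := by simp [hv]
  have hvo : (g.toBilinForm (f y₀)).IsOrthoᵢ v := by
    intro k l hkl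
    simp only [Function.onFun, toBilinForm_apply]
    induction k using Fin.lastCases with
    | last =>
      induction l using Fin.lastCases with
      | last => exact absurd rfl hkl
      | cast j => rw [hvl, hvc, g.symm]; exact hn0 j
    | cast i =>
      induction l using Fin.lastCases with
      | last => rw [hvl, hvc]; exact hn0 i
      | cast j =>
        rw [hvc, hvc]
        exact hβ fun h ↦ hkl (by rw [h])
  have hvd : ∀ k, g.toBilinForm (f y₀) (v k) (v k) ≠ 0 := by
    intro k
    induction k using Fin.lastCases with
    | last => rw [toBilinForm_apply, hvl, hνε]; exact hε
    | cast i => rw [toBilinForm_apply, hvc]; exact hdβ i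
  have hli : LinearIndependent ℝ v := LinearMap.linearIndependent_of_isOrthoᵢ hvo hvd
  haveI : FiniteDimensional ℝ (TangentSpace I (f y₀)) := inferInstanceAs (FiniteDimensional ℝ E)
  have hcard : Fintype.card (Fin (m + 1)) = Module.finrank ℝ (TangentSpace I (f y₀)) := by
    show Fintype.card (Fin (m + 1)) = Module.finrank ℝ E
    rw [hdim, Fintype.card_fin]
  set γ := basisOfLinearIndependentOfCardEqFinrank hli hcard with hγdef
  have hγ : ∀ k, γ k = v k := fun k ↦
    congrFun (coe_basisOfLinearIndependentOfCardEqFinrank hli hcard) k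
  have hγo : (g.toBilinForm (f y₀)).IsOrthoᵢ γ := by
    intro k l hkl
    simp only [Function.onFun, hγ]
    exact hvo hkl
  have hγd : ∀ k, g.val (f y₀) (γ k) (γ k) ≠ 0 := fun k ↦ by
    rw [hγ]; exact hvd k
  -- `K = 0` pointwise
  have hK0 : ∀ a b : TangentSpace I' y₀, g.secondFundamentalForm I' f ν y₀ a b = 0 := fun a b ↦ by
    rw [hK, LinearMap.zero_apply, LinearMap.zero_apply]
  -- the frame Gauss equation on an arbitrary basis `b'` (with `K = 0`)
  have hGauss : ∀ (b' : Module.Basis (Fin m) ℝ (TangentSpace I' y₀)) (i j : Fin m),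
      gN.val y₀ (gN.riemann y₀ (b' i) (b' j) (b' j)) (b' i) =
        g.val (f y₀) (g.riemann (f y₀) (mfderiv I' I f y₀ (b' i)) (mfderiv I' I f y₀ (b' j))
          (mfderiv I' I f y₀ (b' j))) (mfderiv I' I f y₀ (b' i)) := by
    intro b' i j
    have h := gauss_equation_localFrame g hpb hfi (b' := b') (y₀ := y₀) hν hun hε hdim i j
    simp only [localFrame_trivializationAt_self, hK0, mul_zero, sub_zero, zero_div, add_zero] at h
    exact h
  -- notation for the two quartic forms
  set RN : TangentSpace I' y₀ → TangentSpace I' y₀ → TangentSpace I' y₀ → TangentSpace I' y₀ → ℝ :=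
    fun a b c d ↦ gN.val y₀ (gN.riemann y₀ a b c) d with hRN
  set RM : TangentSpace I' y₀ → TangentSpace I' y₀ → TangentSpace I' y₀ → TangentSpace I' y₀ → ℝ :=
    fun a b c d ↦ g.val (f y₀) (g.riemann (f y₀) (mfderiv I' I f y₀ a) (mfderiv I' I f y₀ b)
      (mfderiv I' I f y₀ c)) (mfderiv I' I f y₀ d) with hRM
  -- curvature symmetries for both metrics (O'Neill 1983, Prop. 3.36)
  have two_le : (2 : ℕ∞ω) ≤ ∞ := ENat.LEInfty.out
  have AN : ∀ a b c d, RN a b c d = -RN b a c d := fun a b c d ↦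
    val_curvature_antisymm y₀ a b c d
  have KN : ∀ a b c d, RN a b c d = -RN a b d c := fun a b c d ↦
    hLCN.val_curvature_skew two_le y₀ a b c d
  have PN : ∀ a b c d, RN a b c d = RN c d a b := fun a b c d ↦
    hLCN.val_curvature_pair_symm two_le y₀ a b c d
  have AM : ∀ a b c d, RM a b c d = -RM b a c d := fun a b c d ↦
    val_curvature_antisymm (f y₀) _ _ _ _
  have KM : ∀ a b c d, RM a b c d = -RM a b d c := fun a b c d ↦
    hLC.val_curvature_skew two_le (f y₀) _ _ _ _
  have PM : ∀ a b c d, RM a b c d = RM c d a b := fun a b c d ↦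
    hLC.val_curvature_pair_symm two_le (f y₀) _ _ _ _
  have hsymN : ∀ b a c, RN b a c b = RN b c a b := fun b a c ↦ by
    rw [PN b a c b, AN c b b a, KN b c b a]; ring
  have hsymM : ∀ b a c, RM b a c b = RM b c a b := fun b a c ↦ by
    rw [PM b a c b, AM c b b a, KM b c b a]; ring
  have hGβ : ∀ (b' : Module.Basis (Fin m) ℝ (TangentSpace I' y₀)) (i j : Fin m),
      RN (b' i) (b' j) (b' j) (b' i) = RM (b' i) (b' j) (b' j) (b' i) := fun b' i j ↦ hGauss b' i j
  -- multilinear expansions `Rm(b, a + c, a + c, b) = Rm(b,a,a,b) + 2 Rm(b,a,c,b) + Rm(b,c,c,b)`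
  have eN : ∀ b a c, RN b (a + c) (a + c) b = RN b a a b + 2 * RN b a c b + RN b c c b := by
    intro b a c
    have hs := hsymN b a c
    simp only [hRN, map_add, add_apply] at hs ⊢
    linarith
  have eM : ∀ b a c, RM b (a + c) (a + c) b = RM b a a b + 2 * RM b a c b + RM b c c b := by
    intro b a c
    have hs := hsymM b a c
    simp only [hRM, map_add, add_apply] at hs ⊢
    linarith
  -- the componentwise Gauss equation `Rm_h(βᵢ,βⱼ,βₖ,βᵢ) = Rm_g(dfβᵢ,dfβⱼ,dfβₖ,dfβᵢ)`
  have hcomp : ∀ i j k : Fin m, RN (β i) (β j) (β k) (β i) = RM (β i) (β j) (β k) (β i) := by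
    intro i j k
    by_cases hij : i = j
    · subst hij
      simp only [hRN, hRM, riemann, CovariantDerivative.curvature_self, map_zero,
        zero_apply]
    by_cases hik : i = k
    · subst hik
      have h1 := KN (β i) (β j) (β i) (β i)
      have h2 := KM (β i) (β j) (β i) (β i)
      linarith
    by_cases hjk : j = k
    · subst hjk
      exact hGβ β i j
    -- `j ≠ k`, `i ∉ {j, k}`: polarise on the sheared basis `β' = β` with `β'ⱼ = βⱼ + βₖ`
    let φ : TangentSpace I' y₀ →ₗ[ℝ] TangentSpace I' y₀ := (β.coord j).smulRight (β k)
    have hφapply : ∀ x, φ x = β.coord j x • β k := fun x ↦ rfl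
    have hcoord : ∀ l, β.coord j (β l) = if l = j then 1 else 0 := fun l ↦ by
      rw [Module.Basis.coord_apply, β.repr_self, Finsupp.single_apply]
    have hφβ : ∀ l, φ (β l) = if l = j then β k else 0 := fun l ↦ by
      rw [hφapply, hcoord]
      split_ifs <;> simp
    have hφφ : ∀ x, φ (φ x) = 0 := fun x ↦ by
      rw [hφapply x, map_smul, hφβ, if_neg (Ne.symm hjk), smul_zero]
    have h₁ : (LinearMap.id + φ) ∘ₗ (LinearMap.id - φ) = LinearMap.id := by
      ext x
      simp [hφφ]
    have h₂ : (LinearMap.id - φ) ∘ₗ (LinearMap.id + φ) = LinearMap.id := by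
      ext x
      simp [hφφ]
    let sh : TangentSpace I' y₀ ≃ₗ[ℝ] TangentSpace I' y₀ :=
      LinearEquiv.ofLinear (LinearMap.id + φ) (LinearMap.id - φ) h₁ h₂
    set β' : Module.Basis (Fin m) ℝ (TangentSpace I' y₀) := β.map sh with hβ'
    have hβ'apply : ∀ l, β' l = β l + φ (β l) := fun l ↦ by
      rw [hβ', Module.Basis.map_apply]
      rfl
    have hβ'i : β' i = β i := by rw [hβ'apply, hφβ, if_neg hij, add_zero]
    have hβ'j : β' j = β j + β k := by rw [hβ'apply, hφβ, if_pos rfl]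
    have hG' := hGβ β' i j
    rw [hβ'i, hβ'j, eN, eM] at hG'
    have hGj := hGβ β i j
    have hGk := hGβ β i k
    linarith
  -- the Ricci tensors on basis vectors
  have hric : ∀ j k : Fin m, gN.ricci y₀ (β j) (β k) =
      g.ricci (f y₀) (mfderiv I' I f y₀ (β j)) (mfderiv I' I f y₀ (β k)) -
        g.val (f y₀) (g.riemann (f y₀) (ν y₀) (mfderiv I' I f y₀ (β j))
          (mfderiv I' I f y₀ (β k))) (ν y₀) / ε := by
    intro j k
    rw [ricci_eq_sum_of_isOrthoᵢ gN y₀ β hβ hdβ, ricci_eq_sum_of_isOrthoᵢ g (f y₀) γ hγo hγd,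
      Fin.sum_univ_castSucc]
    simp only [hγ, hvc, hvl, hνε]
    have ha : ∀ i, g.val (f y₀) (mfderiv I' I f y₀ (β i)) (mfderiv I' I f y₀ (β i)) =
        gN.val y₀ (β i) (β i) := fun i ↦ rfl
    simp only [ha]
    rw [add_sub_cancel_right]
    refine Finset.sum_congr rfl fun i _ ↦ ?_
    have hc := hcomp i j k
    simp only [hRN, hRM] at hc
    rw [hc]
  -- extend from the basis to all vectors by bilinearity
  set Nf : LinearMap.BilinForm ℝ (TangentSpace I' y₀) :=
    LinearMap.mk₂ ℝ (fun a b ↦ g.val (f y₀) (g.riemann (f y₀) (ν y₀) (mfderiv I' I f y₀ a)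
        (mfderiv I' I f y₀ b)) (ν y₀))
      (fun a a' b ↦ by simp only [map_add, add_apply])
      (fun c a b ↦ by simp only [map_smul, smul_apply, smul_eq_mul])
      (fun a b b' ↦ by simp only [map_add, add_apply])
      (fun c a b ↦ by simp only [map_smul, smul_apply, smul_eq_mul])
    with hNf
  have hNf_apply : ∀ a b, Nf a b = g.val (f y₀) (g.riemann (f y₀) (ν y₀) (mfderiv I' I f y₀ a)
      (mfderiv I' I f y₀ b)) (ν y₀) := fun a b ↦ rfl
  set B₂ : LinearMap.BilinForm ℝ (TangentSpace I' y₀) :=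
    (g.ricci (f y₀)).comp (mfderiv I' I f y₀).toLinearMap (mfderiv I' I f y₀).toLinearMap -
      ε⁻¹ • Nf with hB₂
  have heq : (gN.ricci y₀ : LinearMap.BilinForm ℝ (TangentSpace I' y₀)) = B₂ := by
    refine LinearMap.BilinForm.ext_basis β fun j k ↦ ?_
    rw [hric j k]
    simp only [hB₂, LinearMap.BilinForm.sub_apply, LinearMap.smul_apply, LinearMap.BilinForm.comp_apply,
      ContinuousLinearMap.coe_coe, hNf_apply, smul_eq_mul]
    ring
  have h := congrArg (fun B : LinearMap.BilinForm ℝ (TangentSpace I' y₀) ↦ B u w) heq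
  simp only [hB₂, LinearMap.BilinForm.sub_apply, LinearMap.smul_apply, LinearMap.BilinForm.comp_apply,
    ContinuousLinearMap.coe_coe, hNf_apply, smul_eq_mul] at h
  rw [h]
  ring


include hfi hpb in
/-- **The tangential Ricci curvature of a Killing field normal to a totally geodesic slice (the
`(i,j)` static field equations): `Ric_g(df u, df w) = Ric_{f^*g}(u, w) − V⁻¹ Hess_{f^*g} V(u, w)`.**
With `f, ν, ε, X = V ν ∘ f` as in `IsKillingField.lapse_mul_dalembertian_eq_neg_ricci` (`X`
Killing, `V ∈ C²`, `K(y) = 0`, `V(y) ≠ 0`): the contracted Gauss equation at the totally geodesic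
point (`ricci_inducedMetric_eq_of_secondFundamentalForm_eq_zero`) with the normal curvatures
`Rm_g(ν, df u, df w, ν) = Rm_g(df u, ν, ν, df w) = −(ε/V) Hess V(u,w)`
(`val_riemann_mfderiv_normal_normal_of_eq_smul_normal`). For `g = -V² dt² + γ` this is
`Ric_g(eᵢ, eⱼ) = Ric_γ(eᵢ, eⱼ) − V⁻¹ ∇ᵢ∇ⱼV`, so that the vacuum equations read
**`Ric(γ) = V⁻¹ ∇²V`, `Δ_γ V = 0`** — the static vacuum Einstein equations of the Riemannian
formulation `(S, γ, V)` (Chruściel–Costa–Heusler 2012, §3.1; Heusler 1996, (2.13)–(2.15);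
Israel 1967). [cite: ChruscielCostaHeusler2012, §3.1 (static vacuum equations Ric(γ) = V⁻¹∇²V)] -/
theorem IsKillingField.ricci_mfderiv_mfderiv_eq_of_eq_smul_normal
    (hun : g.IsUnitNormal I' f ν ε) (hε : ε ≠ 0)
    (hν : ContMDiff I' I.tangent ∞
      (fun x ↦ (TotalSpace.mk' E (f x) (ν x) : TangentBundle I M)))
    (hdim : Module.finrank ℝ E = Module.finrank ℝ E' + 1)
    {X : Π x : M, TangentSpace I x} (hX : g.IsKillingField X)
    {V : N → ℝ} (hV2 : ContMDiff I' 𝓘(ℝ, ℝ) 2 V)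
    (hprop : ∀ y, X (f y) = V y • ν y) {y : N}
    (hK : g.secondFundamentalForm I' f ν y = 0) (hVy : V y ≠ 0) (u w : TangentSpace I' y) :
    haveI := (g.inducedMetric f hpb hfi).hasLeviCivita
    g.ricci (f y) (mfderiv I' I f y u) (mfderiv I' I f y w) =
      (g.inducedMetric f hpb hfi).ricci y u w -
        (V y)⁻¹ * (g.inducedMetric f hpb hfi).hessian V y u w := by
  haveI := (g.inducedMetric f hpb hfi).hasLeviCivita
  have hLC : g.IsLeviCivita g.leviCivita := isLeviCivita_leviCivita_holds
  have h1 := g.ricci_inducedMetric_eq_of_secondFundamentalForm_eq_zero hpb hfi hν hun hε hdim hK u w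
  have h2 := hX.val_riemann_mfderiv_normal_normal_of_eq_smul_normal g hpb hfi hun hε hν hdim hV2
    hprop hK hVy u w
  -- `Rm(ν, a, b, ν) = Rm(a, ν, ν, b)`
  have h3 : g.val (f y) (g.riemann (f y) (ν y) (mfderiv I' I f y u) (mfderiv I' I f y w)) (ν y) =
      g.val (f y) (g.riemann (f y) (mfderiv I' I f y u) (ν y) (ν y)) (mfderiv I' I f y w) := by
    change g.val (f y) (g.leviCivita.curvature (f y) (ν y) (mfderiv I' I f y u)
        (mfderiv I' I f y w)) (ν y) =
      g.val (f y) (g.leviCivita.curvature (f y) (mfderiv I' I f y u) (ν y) (ν y))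
        (mfderiv I' I f y w)
    rw [val_curvature_antisymm (f y), hLC.val_curvature_skew ENat.LEInfty.out (f y), neg_neg]
  rw [h3, h2] at h1
  rw [h1]
  field_simp
  ring

end PseudoRiemannianMetric

end Literature.Geometry.Lorentzian

end
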